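import Summits.CriticalPhenomena.PercolationContinuityZ3.Theorems.PercNearOneGluingNoHeavyLowerTailSahiHubCornerCubeBoxes
import Mathlib.Tactic.Linarith
import Mathlib.Tactic.Positivity
import Mathlib.Tactic.Ring
import HarnessLib

/-!
# `NoHeavyLowerTail` (crux stmt-CriticalPhenomena-4575), P2 — THE SQUARE (ANTIPODAL) IDENTITY FOR THE BOX FORM OF ANY DIMENSION
# and the fibre/environment criterion (gen-29's `crossForm_eq_square` one level up, for every box)

Seat `prim-masterthm-p2`, gen 32 (memo `FROM-prim-masterthm-p2-g32-BOX-FLOWS-AND-STAR.md` §0–§1, SAHI-ROUTE.md §4.59;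
`--supports stmt-CriticalPhenomena-4575`).  No `sorry`, no named facts, standard axioms.

SETTING (`…SahiHubCornerChain`, `…SahiHubCornerCubeBoxes`): hub `z ∈ Fin 2`, co-shared block the cube `Finset κ`, private blocks
`α, β`, point atoms `Fp, Gp, Yp, Jp, Kp`, level mean `Hb`, point kernel `pairKer`, pair form `pairForm = pairKer + pairKerᵀ`, and the
antipodal BOX SUM `boxSum a D = Σ_{u ⊆ D} pairForm(a ∪ u, a ∪ (D∖u))` whose nonnegativity in dimension `|D| ≥ 2` is conjecture FCQ
(⟹ T₁ for every cube co-shared block, `sahiE_three_nonneg_T1_cube_of_boxes`).  The SLOTS of the box are the pairs `(z, a ∪ u)`,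
`z ∈ Fin 2`, `u ⊆ D` — a `(1+|D|)`-cube — with ANTIPODE `(1−z, a ∪ (D∖u))`.
* `Ys z c b = E_a[f_z(c,·) h_z(·,b)]` (slice), `Mq z c z' c' = E_b[g_z(c,·) Ys_{z'}(c',·)]` (mixed fibre moment).
* For a ratio `ρ : Fin 2 → Finset κ → ℝ` on the slots and an antipodal pair of block points `(x, y)`:
  `kerPair ρ x y b` — the FIBRE KERNEL of the two slots over `x`:
    `g_{1x}[(2−ρ_{1x})Ys_{1x} − F_{0y}H₁ − (1−ρ_{0y})Ys_{0y}] + g_{0x}[(2−ρ_{0x})Ys_{0x} − F_{1y}H₀ − (1−ρ_{1y})Ys_{1y}]` (at the fibre `b`);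
  `cpPair ρ x y` — the slice covariances `ρ_{1x}Cov_b(g_{1x},Ys_{1x}) + (1−ρ_{0y})Cov_b(g_{1x},Ys_{0y}) + (level 0 alike)`;
  `envPair ρ x y` — the ENVIRONMENT part (section means, slice masses, `H̄₀, H̄₁` only).
* **`pairKer_eq_slot`** (pure algebra, any `ρ`): `pairKer x y = Σ_b wB(b)·kerPair ρ x y b + cpPair ρ x y + envPair ρ x y`.
* `boxFib`, `boxCP`, `boxEnv` — their sums over the antipodal pairs `(a ∪ u, a ∪ (D∖u))`, `u ⊆ D`, of the box;
  **`boxSum_eq_square` (THE SQUARE IDENTITY, every dimension):** `boxSum a D = 2·(Σ_b wB(b)·boxFib ρ a D b + boxCP ρ a D + boxEnv ρ a D)`.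
  (`|D| = 1`, `a = ∅`: gen 29's `crossForm_eq_square` for the two-point family.)
* `boxCP_nonneg` (`ρ ∈ [0,1]`, FKG on `β`) and **`boxSum_nonneg_of_fibre` (THE CRITERION):** if some `ρ ∈ [0,1]` makes the fibre
  kernel `boxFib ρ a D b ≥ 0` at every fibre `b` and `boxEnv ρ a D ≥ 0`, then `boxSum a D ≥ 0`.
The companion `…SahiHubCornerBoxStar` discharges the fibre hypothesis for every STAR ratio by the tree's antipodal lemma
(`SahiBox.antipodal_box`) on the `(1+|D|)`-cube of slots.  HONEST LABEL: identity + criterion; the box inequalities, T₁ with ≥ 2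
co-shared coins and Kahn's `C₃` OPEN. [this work]
-/

noncomputable section

open scoped Classical

namespace Summit.CriticalPhenomena.PercolationContinuityZ3.Theorems

namespace SahiHubCornerChain

open Finset Literature.Combinatorics.Sahi2008 SahiHubCorner SahiHubTwoLevel
open SahiTriangleSupermodular (fkg_sum)

section Defs

variable {κ α β : Type} [Fintype α] [Fintype β]
  (wA : α → ℝ) (wB : β → ℝ) (f : Fin 2 → Finset κ → α → ℝ) (g : Fin 2 → Finset κ → β → ℝ) (h : Fin 2 → α → β → ℝ)

/-- Slice `Ys_z(c,b) = E_a[f_z(c,a) h_z(a,b)]`. [this work] -/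
def Ys (z : Fin 2) (c : Finset κ) (b : β) : ℝ := ∑ a, wA a * (f z c a * h z a b)

/-- Mixed fibre moment `Mq(z,c;z',c') = E_b[g_z(c,b)·Ys_{z'}(c',b)]`. [this work] -/
def Mq (z : Fin 2) (c : Finset κ) (z' : Fin 2) (c' : Finset κ) : ℝ := ∑ b, wB b * (g z c b * Ys wA f h z' c' b)

variable (ρ : Fin 2 → Finset κ → ℝ)

/-- **Fibre kernel of the two slots over the block point `x`** (antipodal partner point `y`), at the fibre `b`:
`g_{1x}[(2−ρ_{1x})Ys_{1x} − F_{0y}H₁ − (1−ρ_{0y})Ys_{0y}] + g_{0x}[(2−ρ_{0x})Ys_{0x} − F_{1y}H₀ − (1−ρ_{1y})Ys_{1y}]`. [this work] -/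
def kerPair (x y : Finset κ) (b : β) : ℝ :=
  g 1 x b * ((2 - ρ 1 x) * Ys wA f h 1 x b - Fp wA f 0 y * Hsl wA h 1 b - (1 - ρ 0 y) * Ys wA f h 0 y b)
  + g 0 x b * ((2 - ρ 0 x) * Ys wA f h 0 x b - Fp wA f 1 y * Hsl wA h 0 b - (1 - ρ 1 y) * Ys wA f h 1 y b)

/-- Slice-covariance part of the two slots over `x`:
`ρ_{1x}Cov_b(g_{1x},Ys_{1x}) + (1−ρ_{0y})Cov_b(g_{1x},Ys_{0y}) + ρ_{0x}Cov_b(g_{0x},Ys_{0x}) + (1−ρ_{1y})Cov_b(g_{0x},Ys_{1y})`. [this work] -/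
def cpPair (x y : Finset κ) : ℝ :=
  ρ 1 x * (Mq wA wB f g h 1 x 1 x - Gp wB g 1 x * Yp wA wB f h 1 x)
  + (1 - ρ 0 y) * (Mq wA wB f g h 1 x 0 y - Gp wB g 1 x * Yp wA wB f h 0 y)
  + ρ 0 x * (Mq wA wB f g h 0 x 0 x - Gp wB g 0 x * Yp wA wB f h 0 x)
  + (1 - ρ 1 y) * (Mq wA wB f g h 0 x 1 y - Gp wB g 0 x * Yp wA wB f h 1 y)

/-- Environment part of the two slots over `x` (antipodal partner `y`): section means, slice masses and `H̄₀, H̄₁` only. [this work] -/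
def envPair (x y : Finset κ) : ℝ :=
  ρ 1 x * Gp wB g 1 x * Yp wA wB f h 1 x + ρ 0 x * Gp wB g 0 x * Yp wA wB f h 0 x
  - ρ 0 y * Gp wB g 1 x * Yp wA wB f h 0 y - ρ 1 y * Gp wB g 0 x * Yp wA wB f h 1 y
  - Hb wA wB h 0 * Fp wA f 1 x * Gp wB g 1 x - Hb wA wB h 1 * Fp wA f 0 x * Gp wB g 0 x
  - Fp wA f 1 y * Gp wB g 1 x * Hb wA wB h 1 + Fp wA f 0 y * Gp wB g 1 x * Hb wA wB h 1
  + Fp wA f 1 y * Gp wB g 0 x * Hb wA wB h 1 + Fp wA f 1 y * Gp wB g 1 x * Hb wA wB h 0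

variable (a D : Finset κ)

/-- Fibre kernel of the whole box `[a, a ∪ D]` at the fibre `b` (sum over the antipodal pairs `(a ∪ u, a ∪ (D∖u))`). [this work] -/
def boxFib (b : β) : ℝ := ∑ u ∈ D.powerset, kerPair wA f g h ρ (a ∪ u) (a ∪ (D \ u)) b
/-- Slice-covariance part of the whole box. [this work] -/
def boxCP : ℝ := ∑ u ∈ D.powerset, cpPair wA wB f g h ρ (a ∪ u) (a ∪ (D \ u))
/-- **Environment remainder of the whole box** (the quantity a certificate must make nonnegative). [this work] -/
def boxEnv : ℝ := ∑ u ∈ D.powerset, envPair wA wB f g h ρ (a ∪ u) (a ∪ (D \ u))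

end Defs

section Identity

variable {κ α β : Type} [Fintype α] [Fintype β]
  {wA : α → ℝ} {wB : β → ℝ} {f : Fin 2 → Finset κ → α → ℝ} {g : Fin 2 → Finset κ → β → ℝ} {h : Fin 2 → α → β → ℝ}
  {ρ : Fin 2 → Finset κ → ℝ}

/-- `Σ_b wB(b)·kerPair` in the mixed moments. [this work] -/
theorem sum_kerPair (x y : Finset κ) :
    (∑ b, wB b * kerPair wA f g h ρ x y b) =
      (2 - ρ 1 x) * Mq wA wB f g h 1 x 1 x - Fp wA f 0 y * Kp wA wB g h 1 x - (1 - ρ 0 y) * Mq wA wB f g h 1 x 0 y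
      + ((2 - ρ 0 x) * Mq wA wB f g h 0 x 0 x - Fp wA f 1 y * Kp wA wB g h 0 x - (1 - ρ 1 y) * Mq wA wB f g h 0 x 1 y) := by
  have e : ∀ b, wB b * kerPair wA f g h ρ x y b =
      (2 - ρ 1 x) * (wB b * (g 1 x b * Ys wA f h 1 x b)) - Fp wA f 0 y * (wB b * (g 1 x b * Hsl wA h 1 b))
        - (1 - ρ 0 y) * (wB b * (g 1 x b * Ys wA f h 0 y b))
      + ((2 - ρ 0 x) * (wB b * (g 0 x b * Ys wA f h 0 x b)) - Fp wA f 1 y * (wB b * (g 0 x b * Hsl wA h 0 b))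
        - (1 - ρ 1 y) * (wB b * (g 0 x b * Ys wA f h 1 y b))) := fun b => by
    unfold kerPair; ring
  simp only [e, sum_add_distrib, sum_sub_distrib, ← mul_sum]
  rfl

/-- **THE SLOT IDENTITY** (pure bookkeeping, any `ρ`): `pairKer x y = Σ_b wB·kerPair ρ x y + cpPair ρ x y + envPair ρ x y`. [this work] -/
theorem pairKer_eq_slot (x y : Finset κ) :
    pairKer wA wB f g h x y = (∑ b, wB b * kerPair wA f g h ρ x y b) + cpPair wA wB f g h ρ x y + envPair wA wB f g h ρ x y := by
  rw [sum_kerPair]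
  have hJ : ∀ z c, Jp wA wB f g h z c = Mq wA wB f g h z c z c := fun z c => rfl
  unfold pairKer cpPair envPair
  rw [hJ, hJ]
  ring

/-- Each unordered antipodal pair is counted twice: `boxSum a D = 2·Σ_{u ⊆ D} pairKer(a ∪ u, a ∪ (D∖u))`. [this work] -/
theorem boxSum_eq_two_mul_sum_pairKer (a D : Finset κ) :
    boxSum wA wB f g h a D = 2 * ∑ u ∈ D.powerset, pairKer wA wB f g h (a ∪ u) (a ∪ (D \ u)) := by
  unfold boxSum
  have hsplit : ∑ u ∈ D.powerset, pairForm wA wB f g h (a ∪ u) (a ∪ (D \ u)) =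
      ∑ u ∈ D.powerset, pairKer wA wB f g h (a ∪ u) (a ∪ (D \ u)) + ∑ u ∈ D.powerset, pairKer wA wB f g h (a ∪ (D \ u)) (a ∪ u) := by
    rw [← sum_add_distrib]
    exact sum_congr rfl fun u _ => pairForm_eq_pairKer _ _
  -- reindex the second sum along the involution `u ↦ D \ u` of the box
  have hflip : ∑ u ∈ D.powerset, pairKer wA wB f g h (a ∪ (D \ u)) (a ∪ u) =
      ∑ u ∈ D.powerset, pairKer wA wB f g h (a ∪ u) (a ∪ (D \ u)) := by
    refine sum_nbij' (fun u => D \ u) (fun u => D \ u) (fun u _ => mem_powerset.2 sdiff_subset)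
      (fun u _ => mem_powerset.2 sdiff_subset) (fun u hu => ?_) (fun u hu => ?_) (fun u hu => ?_)
    · exact Finset.sdiff_sdiff_eq_self (mem_powerset.1 hu)
    · exact Finset.sdiff_sdiff_eq_self (mem_powerset.1 hu)
    · rw [Finset.sdiff_sdiff_eq_self (mem_powerset.1 hu)]
  rw [hsplit, hflip]
  ring

/-- **THE SQUARE IDENTITY FOR A BOX OF ANY DIMENSION**: for every ratio `ρ` on the slots,
`boxSum a D = 2·(Σ_b wB(b)·boxFib ρ a D b + boxCP ρ a D + boxEnv ρ a D)`. [this work] -/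
theorem boxSum_eq_square (ρ : Fin 2 → Finset κ → ℝ) (a D : Finset κ) :
    boxSum wA wB f g h a D =
      2 * ((∑ b, wB b * boxFib wA f g h ρ a D b) + boxCP wA wB f g h ρ a D + boxEnv wA wB f g h ρ a D) := by
  rw [boxSum_eq_two_mul_sum_pairKer]
  congr 1
  unfold boxFib boxCP boxEnv
  rw [sum_congr rfl fun u _ => pairKer_eq_slot (ρ := ρ) (a ∪ u) (a ∪ (D \ u)), sum_add_distrib, sum_add_distrib]
  congr 2
  simp only [mul_sum]
  rw [sum_comm]

end Identity

section Positivity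

variable {κ α β : Type} [Fintype α] [Fintype β]
  {wA : α → ℝ} {wB : β → ℝ} {f : Fin 2 → Finset κ → α → ℝ} {g : Fin 2 → Finset κ → β → ℝ} {h : Fin 2 → α → β → ℝ}

omit [Fintype β] in
/-- Slices are increasing in the fibre variable (`wA ≥ 0`, `f ≥ 0`, `h` increasing in `b`). [this work] -/
theorem Ys_mono_b [Preorder β] (hA0 : ∀ a, 0 ≤ wA a) (hf0 : ∀ z c a, 0 ≤ f z c a) (hhb : ∀ z a, Monotone (h z a))
    (z : Fin 2) (c : Finset κ) : Monotone (Ys wA f h z c) := fun _ _ hbb' =>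
  sum_le_sum fun a _ => mul_le_mul_of_nonneg_left (mul_le_mul_of_nonneg_left (hhb z a hbb') (hf0 z c a)) (hA0 a)

omit [Fintype β] in
/-- Slices are nonnegative. [this work] -/
theorem Ys_nonneg (hA0 : ∀ a, 0 ≤ wA a) (hf0 : ∀ z c a, 0 ≤ f z c a) (hh0 : ∀ z a b, 0 ≤ h z a b)
    (z : Fin 2) (c : Finset κ) (b : β) : 0 ≤ Ys wA f h z c b :=
  sum_nonneg fun a _ => mul_nonneg (hA0 a) (mul_nonneg (hf0 z c a) (hh0 z a b))

/-- `Yp` is the fibre average of `Ys`. [this work] -/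
theorem Yp_eq_sum_Ys (z : Fin 2) (c : Finset κ) : Yp wA wB f h z c = ∑ b, wB b * Ys wA f h z c b := rfl

/-- **Slice covariances are nonnegative** (FKG on `β`): `Mq(z,c;z',c') ≥ Gp_z(c)·Yp_{z'}(c')`. [this work] -/
theorem Mq_sub_nonneg [DistribLattice β] (hB : IsFKGMeasure wB) (hA0 : ∀ a, 0 ≤ wA a)
    (hf0 : ∀ z c a, 0 ≤ f z c a) (hg0 : ∀ z c b, 0 ≤ g z c b) (hgb : ∀ z c, Monotone (g z c))
    (hh0 : ∀ z a b, 0 ≤ h z a b) (hhb : ∀ z a, Monotone (h z a)) (z : Fin 2) (c : Finset κ) (z' : Fin 2) (c' : Finset κ) :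
    0 ≤ Mq wA wB f g h z c z' c' - Gp wB g z c * Yp wA wB f h z' c' := by
  unfold Mq Gp
  rw [Yp_eq_sum_Ys]
  exact sub_nonneg.2 (fkg_sum hB (hg0 z c) (Ys_nonneg hA0 hf0 hh0 z' c') (hgb z c) (Ys_mono_b hA0 hf0 hhb z' c'))

/-- **`boxCP ≥ 0` for `ρ ∈ [0,1]`.** [this work] -/
theorem boxCP_nonneg [DistribLattice β] (hB : IsFKGMeasure wB) (hA0 : ∀ a, 0 ≤ wA a)
    (hf0 : ∀ z c a, 0 ≤ f z c a) (hg0 : ∀ z c b, 0 ≤ g z c b) (hgb : ∀ z c, Monotone (g z c))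
    (hh0 : ∀ z a b, 0 ≤ h z a b) (hhb : ∀ z a, Monotone (h z a))
    {ρ : Fin 2 → Finset κ → ℝ} (hρ0 : ∀ z c, 0 ≤ ρ z c) (hρ1 : ∀ z c, ρ z c ≤ 1) (a D : Finset κ) :
    0 ≤ boxCP wA wB f g h ρ a D := by
  unfold boxCP
  refine sum_nonneg fun u _ => ?_
  have c := Mq_sub_nonneg hB hA0 hf0 hg0 hgb hh0 hhb
  unfold cpPair
  have t1 := mul_nonneg (hρ0 1 (a ∪ u)) (c 1 (a ∪ u) 1 (a ∪ u))
  have t2 := mul_nonneg (sub_nonneg.2 (hρ1 0 (a ∪ (D \ u)))) (c 1 (a ∪ u) 0 (a ∪ (D \ u)))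
  have t3 := mul_nonneg (hρ0 0 (a ∪ u)) (c 0 (a ∪ u) 0 (a ∪ u))
  have t4 := mul_nonneg (sub_nonneg.2 (hρ1 1 (a ∪ (D \ u)))) (c 0 (a ∪ u) 1 (a ∪ (D \ u)))
  linarith

/-- **THE CRITERION (any dimension).**  If some ratio `ρ ∈ [0,1]` on the slots makes the fibre kernel of the box nonnegative at every
fibre and the environment remainder nonnegative, then the antipodal box sum is nonnegative: `boxSum a D ≥ 0`. [this work] -/
theorem boxSum_nonneg_of_fibre [DistribLattice β] (hB : IsFKGMeasure wB) (hA0 : ∀ a, 0 ≤ wA a)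
    (hf0 : ∀ z c a, 0 ≤ f z c a) (hg0 : ∀ z c b, 0 ≤ g z c b) (hgb : ∀ z c, Monotone (g z c))
    (hh0 : ∀ z a b, 0 ≤ h z a b) (hhb : ∀ z a, Monotone (h z a))
    {ρ : Fin 2 → Finset κ → ℝ} (hρ0 : ∀ z c, 0 ≤ ρ z c) (hρ1 : ∀ z c, ρ z c ≤ 1) (a D : Finset κ)
    (hfib : ∀ b, 0 ≤ boxFib wA f g h ρ a D b) (henv : 0 ≤ boxEnv wA wB f g h ρ a D) :
    0 ≤ boxSum wA wB f g h a D := by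
  rw [boxSum_eq_square ρ a D]
  have h1 : 0 ≤ ∑ b, wB b * boxFib wA f g h ρ a D b := sum_nonneg fun b _ => mul_nonneg (hB.nonneg b) (hfib b)
  have h2 := boxCP_nonneg hB hA0 hf0 hg0 hgb hh0 hhb hρ0 hρ1 a D
  linarith

end Positivity

end SahiHubCornerChain

end Summit.CriticalPhenomena.PercolationContinuityZ3.Theorems
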